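import Summits.AtomisticToContinuum.Crystallization.Theorems.FrustratedLawDichotomyStrainedPatchHomEntryFit

/-!
# The SHARP reflected (P1) fit prune on fcc entry boxes: Pythagorean misfit bound at the minimising scale

decomp-a2c hand-2 g22 (crux `AperiodicFrustratedLawGap`, stmt-AtomisticToContinuum-27623; sequel of `…HomEntryFit`).  MEASURED natively with the tree's own
verdicts: on the ray `U = s·1` `fitOK` fires for all `s ∈ [0.90, 1.06]` (half-width `2⁻⁹`) while (P4) at `m = 1/625` is false exactly for `s ∈ [0.95, 0.99]`; under
uniaxial strain `U = 0.97·diag(1+e,1,1)` (half-width `2⁻¹⁰`) `fitOK` holds for `e ≤ 0.03`, (P4) from `e ≥ 0.05` — a GAP at `e = 0.04` (true fit limit `e ≈ 0.069`;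
`fitOK`'s `2ρ` is loose by ≈ 1.5×).  Sharp bound: `‖Uq − d q‖² = (⟪Uq,q⟫ − d)² + (‖Uq‖² − ⟪Uq,q⟫²)`, `⟪Uq,q⟫ = λ + ⟪Vq,q⟫`, tangential part
`‖Vq‖² − ⟪Vq,q⟫²` (width-robust), radial part `−(tangential) ≤ λ + ⟪Vq,q⟫ − d ≤ ⟪Vq,q⟫ − min_q' ⟪Vq',q'⟫` at the MINIMISING scale `d`.
* §1 `goodAtScale_of_fitBounds_min` (fit required only at the minimising scale); §2 `pMin`, `tangHi`, ★ `fitOK2`, ★★ `fitOK2_sound`;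
* §3 `entryLeafOKF2 μ := fitOK2 ∨ entryLeafOKF μ` (both fit verdicts kept: `fitOK` wins on large boxes near the ray, `fitOK2` near the frontier), soundness,
  ★★★ `fccHalf_of_entryFit2Tree`; §4 kernel smoke test: `fitOK2` fires at `U = 0.97·diag(1.04,1,1)` (half-width `2⁻¹⁰`) where `fitOK` fails (native per-label
  ratios `≤ 0.87` at `e = 0.04`; `1.16` at `e = 0.05` on four labels — there (P4) holds).
All definitions computable; 0 sorry; standard axioms; no instances / notation.  `--supports stmt-AtomisticToContinuum-27623`.
-/

namespace Summit.AtomisticToContinuum.Crystallization.Theorems.FrustratedLawDichotomyStrainedPatchHomEntryFitSharp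

open scoped BigOperators RealInnerProductSpace
open Literature.Analysis.ValidatedNumerics.Numerics
open Literature.Geometry.DiscreteGeometry (fccKissingPattern fccInt card_fccKissingPattern norm_eq_one_of_mem_fccKissingPattern)
open Summit.AtomisticToContinuum.Crystallization.Theorems.ChargedEnergyGapNegative (E3)
open Summit.AtomisticToContinuum.Crystallization.Theorems.FrustratedLawDichotomySchurCut (effPot w₄₅ ω₄)
open Summit.AtomisticToContinuum.Crystallization.Theorems.FrustratedLawDichotomyMotifLemmas (GoodAtScale)
open Summit.AtomisticToContinuum.Crystallization.Theorems.FrustratedLawDichotomyAveragingRuleTightFree (TightNearCap BadNearCap)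
open Summit.AtomisticToContinuum.Crystallization.Theorems.FrustratedLawDichotomyExemptAbsorption (ExemptNear)
open Summit.AtomisticToContinuum.Crystallization.Theorems.FrustratedLawDichotomyStrainedPatchHomSplit
open Summit.AtomisticToContinuum.Crystallization.Theorems.FrustratedLawDichotomyStrainedPatchHomRelief (latPt_fccVec_eq)
open Summit.AtomisticToContinuum.Crystallization.Theorems.FrustratedLawDichotomyStrainedPatchHomLatticeBox
  (norm_apply_ge_of_near_one latPt_zero mem_box_of_norm_fccPoint_lt)
open Summit.AtomisticToContinuum.Crystallization.Theorems.FrustratedLawDichotomyStrainedPatchHomPrunesFit (goodAtScale_centre_of_fit_fcc)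
open Summit.AtomisticToContinuum.Crystallization.Theorems.FrustratedLawDichotomyStrainedPatchHomPruned (pruneFcc_of_centre_good)
open Summit.AtomisticToContinuum.Crystallization.Theorems.FrustratedLawDichotomyStrainedPatchHomPolar (norm_apply_le_of_norm_sub_one_le)
open Summit.AtomisticToContinuum.Crystallization.Theorems.FrustratedLawDichotomyStrainedPatchHomCertTree
open Summit.AtomisticToContinuum.Crystallization.Theorems.FrustratedLawDichotomyStrainedPatchHomEntryGram
open Summit.AtomisticToContinuum.Crystallization.Theorems.FrustratedLawDichotomyStrainedPatchHomEntryFitKit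
open Summit.AtomisticToContinuum.Crystallization.Theorems.FrustratedLawDichotomyStrainedPatchHomEntryFit
open Literature.Barriers.AtomisticToContinuum.FlatleyTheil2015 (fccVec fccPoint)
/-! ## §1. The real fit theorem, fit at the minimising scale only -/
/-- ★★ **CENTRE `1/20`-GOOD FROM FIT BOUNDS, fit required only at the MINIMISING scale** (def-free; `…HomEntryFit.goodAtScale_of_fitBounds` verbatim
except that (F1) carries the premise `∀ q'', ‖U q'‖ ≤ ‖U q''‖`). [folklore] -/
theorem goodAtScale_of_fitBounds_min (U : E3 →L[ℝ] E3) (hU : ‖U - 1‖ ≤ 1 / 4) {dlo dhi : ℝ} (hdlo : 0 < dlo) (hdhi : dhi ≤ 3 / 2)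
    (hthr : 8 * (13 / 10 * dhi + 1 / 100) ^ 2 < 27)
    (hlo : ∀ q ∈ fccKissingPattern, dlo ≤ ‖U q‖) (hhi : ∃ q ∈ fccKissingPattern, ‖U q‖ ≤ dhi)
    {d2lo : ℝ} (hd2 : ∀ q ∈ fccKissingPattern, d2lo ≤ ‖U q‖ ^ 2)
    (hfit : ∀ q ∈ fccKissingPattern, ∀ q' ∈ fccKissingPattern, (∀ q'' ∈ fccKissingPattern, ‖U q'‖ ≤ ‖U q''‖) →
      ‖U q - ‖U q'‖ • q‖ ^ 2 ≤ (49 / 1000 : ℝ) ^ 2 * d2lo)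
    (hcl : ∀ q ∈ fccKissingPattern, ‖U q‖ ≤ 13 / 10 * dlo - 1 / 100)
    (hfar : ∀ b ∈ (Fintype.piFinset fun _ : Fin 3 => Finset.Icc (-2 : ℤ) 2), b ≠ 0 → recon b ∉ fccInt →
      13 / 10 * dhi + 1 / 100 ≤ ‖latPt U fccVec b‖) :
    ∀ (M : ℕ) (z : Fin M → E3) (c : Fin M), Function.Injective z →
      (∀ x : E3, dist x (z c) < 15 / 2 → (x ∈ Set.range z ↔ x - z c ∈ {v : E3 | ∃ b : Fin 3 → ℤ, v = latPt U fccVec b})) →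
      GoodAtScale (1 / 20) (3 / 2) z c := by
  intro M z c _hz hT
  have hne : fccKissingPattern.Nonempty := by rw [← Finset.card_pos, card_fccKissingPattern]; norm_num
  obtain ⟨q₀, hq₀, hdq₀⟩ := Finset.exists_mem_eq_inf' hne (fun q : E3 => ‖U q‖)
  -- `d := ‖U q₀‖` is the minimum over the pattern
  have hd_le : ∀ q ∈ fccKissingPattern, ‖U q₀‖ ≤ ‖U q‖ := fun q hq => by rw [← hdq₀]; exact Finset.inf'_le _ hq
  have hdlo_d : dlo ≤ ‖U q₀‖ := hlo q₀ hq₀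
  have hd_dhi : ‖U q₀‖ ≤ dhi := by obtain ⟨q, hq, h⟩ := hhi; exact (hd_le q hq).trans h
  have hd0 : 0 < ‖U q₀‖ := hdlo.trans_le hdlo_d
  have hmemT : ∀ q ∈ fccKissingPattern, U q ∈ {v : E3 | ∃ b : Fin 3 → ℤ, v = latPt U fccVec b} := fun q hq => by
    obtain ⟨b, _, rfl⟩ := exists_label_of_mem_pattern hq
    exact ⟨b, (latPt_fccVec_eq U b).symm⟩
  -- index box for short lattice vectors
  have hbox2 : ∀ b : Fin 3 → ℤ, ‖latPt U fccVec b‖ < 13 / 10 * ‖U q₀‖ + 1 / 100 →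
      b ∈ Fintype.piFinset fun _ : Fin 3 => Finset.Icc (-(2 : ℕ) : ℤ) (2 : ℕ) := fun b hb => by
    refine mem_box_of_norm_fccPoint_lt (R := 13 / 10 * dhi + 1 / 100) (by push_cast; linarith) ?_
    have h34 := norm_apply_ge_of_near_one hU (fccPoint b)
    rw [← latPt_fccVec_eq] at h34
    linarith
  refine goodAtScale_centre_of_fit_fcc hT (d := ‖U q₀‖) (η' := 49 / 1000) (γ := 1 / 100) (A := LinearIsometry.id)
    (t' := fun u => U (u : E3)) (hd_dhi.trans hdhi) hd0 (by norm_num) (by norm_num) (by linarith) ?_ ?_ ?_ ?_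
  · -- (hfit)
    intro u
    have hu1 : ‖(u : E3)‖ = 1 := norm_eq_one_of_mem_fccKissingPattern u.2
    refine ⟨hmemT u u.2, ?_, ?_⟩
    · have := norm_apply_le_of_norm_sub_one_le hU (u : E3)
      rw [hu1] at this
      show ‖U (u : E3)‖ < 15 / 2
      linarith
    · have g := hfit u u.2 q₀ hq₀ hd_le
      have h2 := hd2 q₀ hq₀
      have hsq : ‖U (u : E3) - ‖U q₀‖ • (u : E3)‖ ^ 2 ≤ (49 / 1000 * ‖U q₀‖) ^ 2 := by linarith
      show ‖U (u : E3) - ‖U q₀‖ • (LinearIsometry.id (u : E3))‖ ≤ 49 / 1000 * ‖U q₀‖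
      rw [LinearIsometry.id_apply]
      exact (abs_le_of_sq_le_sq' hsq (by positivity)).2
  · -- (hlow)
    rintro w ⟨b, rfl⟩ hw0 hlt
    by_cases hrec : recon b ∈ fccInt
    · rw [latPt_fccVec_eq]; exact hd_le _ (fccPoint_mem_pattern_of_recon hrec)
    · exfalso
      have hb0 : b ≠ 0 := by rintro rfl; exact hw0 (latPt_zero U fccVec)
      have hmem := hbox2 b hlt
      have := hfar b (by simpa using hmem) hb0 hrec
      linarith
  · -- (hex)
    refine ⟨U q₀, hmemT q₀ hq₀, fun h0 => ?_, le_rfl⟩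
    rw [h0, norm_zero] at hd0
    exact lt_irrefl _ hd0
  · -- (hclean)
    rintro w ⟨b, rfl⟩ hw0 hlt
    by_cases hrec : recon b ∈ fccInt
    · have hpat := fccPoint_mem_pattern_of_recon hrec
      refine ⟨?_, ⟨⟨fccPoint b, hpat⟩, (latPt_fccVec_eq U b).symm⟩⟩
      rw [latPt_fccVec_eq]
      linarith [hcl _ hpat]
    · exfalso
      have hb0 : b ≠ 0 := by rintro rfl; exact hw0 (latPt_zero U fccVec)
      have hmem := hbox2 b hlt
      have := hfar b (by simpa using hmem) hb0 hrec
      linarith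
/-! ## §2. The sharp kernel verdict and its soundness -/
/-- Smallest lower end of `⟪Vq', q'⟫` over the twelve kissing labels (scaled). -/
def pMin (c w : Fin 3 × Fin 3 → ℤ) (L : ℤ) : ℤ := lmin (K12.map fun b => (qformFI (hgramD c w L) b).lo)
/-- Upper end of the tangential part `‖Vq‖² − ⟪Vq, q⟫²` of the label `b`, floored at `0` (scaled). -/
def tangHi (c w : Fin 3 × Fin 3 → ℤ) (L : ℤ) (b : Fin 3 → ℤ) : ℤ :=
  max 0 ((qformFI (gramD c w L) b).sub ((qformFI (hgramD c w L) b).mul (qformFI (hgramD c w L) b))).hi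
/-- ★ **THE (P1) FIT VERDICT on an entry box** (scaled integers; `L = scaleL c`, `D = dEncl`, `Dsq = dSq`, `S b = kissSq`, `N b = qformFI (gramT c w) b`):
`0 ≤ L`, `0 < D.lo ≤ D.hi ≤ 3SC/2`, `8 thr² < 27` (`thr = 13 D.hi/10 + SC/100`), `SC ≤ 130 D.lo`; the fit `4·10⁶ ρ² ≤ 2401 Dsq.lo` (misfit `≤ 2ρ ≤ (49/1000) d`);
per kissing label the clean gap `S.hi ≤ (13 D.lo/10 − SC/100)²`; per off-shell label of `[−2,2]³` the far bound `thr² ≤ N.lo`. -/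
def fitOK2 (c w : Fin 3 × Fin 3 → ℤ) : Bool :=
  let L := scaleL c
  decide (0 ≤ L) && decide (0 < (dEncl c w L).lo) && decide ((dEncl c w L).lo ≤ (dEncl c w L).hi) && decide (2 * (dEncl c w L).hi ≤ 3 * (SC : ℤ)) &&
  decide (8 * (130 * (dEncl c w L).hi + SC) ^ 2 < 270000 * ((SC : ℤ) * SC)) && decide ((SC : ℤ) ≤ 130 * (dEncl c w L).lo) &&
  K12.all (fun b =>
    decide ((SC : ℤ) ≤ 2 * (L + (qformFI (hgramD c w L) b).lo)) &&
    decide (1000000 * ((max 0 ((qformFI (hgramD c w L) b).hi - pMin c w L)) ^ 2 + (tangHi c w L b) ^ 2 + tangHi c w L b * SC) ≤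
      2401 * (dSq c w L).lo * SC) &&
    decide ((kissSq c w L b).hi * SC * 10000 ≤ (130 * (dEncl c w L).lo - SC) ^ 2)) &&
  decide (∀ b ∈ box2, b ≠ 0 → recon b ∉ fccInt → (130 * (dEncl c w L).hi + (SC : ℤ)) ^ 2 ≤ (qformFI (gramT c w) b).lo * SC * 10000)
/-- ★★ **SOUNDNESS OF THE SHARP FIT VERDICT**: `fitOK2 c w = true` ⟹ the prune disjunct `PruneFcc U` for every `U` with `‖U − 1‖ ≤ 1/4` whose entries lie in
the box. [folklore] -/
theorem fitOK2_sound {c w : Fin 3 × Fin 3 → ℤ} (h : fitOK2 c w = true) (U : E3 →L[ℝ] E3) (hU : ‖U - 1‖ ≤ 1 / 4)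
    (hbox : ∀ ab : Fin 3 × Fin 3, |(U (EuclideanSpace.single ab.2 (1 : ℝ))) ab.1 - (c ab : ℝ) / SC| ≤ (w ab : ℝ) / SC) :
    ∀ (M : ℕ) (z : Fin M → E3) (c : Fin M), Function.Injective z →
      Set.range z = {x : E3 | dist x (z c) ≤ 133 / 10 ∧ ∃ a : Fin 3 → ℤ, x = z c + latPt U fccVec a} →
      TightNearCap (9 / 5) (3 / 2) z c ∨ ExemptNear (9 / 5) ExRec z c ∨ BadNearCap (9 / 5) (3 / 2) z c := by
  simp only [fitOK2, Bool.and_eq_true, decide_eq_true_eq, List.all_eq_true] at h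
  obtain ⟨⟨⟨⟨⟨⟨⟨hL0, h0⟩, h01⟩, h32⟩, hthr⟩, h130⟩, hK⟩, hfar⟩ := h
  have hS := SC_pos
  have hne := SC_ne
  -- the deviation `V = U − λ·1` and the real identities
  set lam : ℝ := (scaleL c : ℝ) / SC with hlam
  have hlam0 : 0 ≤ lam := div_nonneg (by exact_mod_cast hL0) hS.le
  set V : E3 →L[ℝ] E3 := U - lam • (1 : E3 →L[ℝ] E3) with hVdef
  have hV : ∀ x : E3, U x = lam • x + V x := fun x => by
    have : V x = U x - lam • x := by simp [hVdef]
    rw [this]; abel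
  have hE' := mem_devFI U (scaleL c) hbox
  have hN' : ∀ b, FI.mem (‖V (fccPoint b)‖ ^ 2) (qformFI (gramD c w (scaleL c)) b) := fun b => by
    rw [← latPt_fccVec_eq, FrustratedLawDichotomyStrainedPatchHomGram.norm_sq_latPt_eq_sum_gram]
    exact mem_qformFI (fun i j => mem_gramFI V hE' i j) b
  have hP' : ∀ b, FI.mem ⟪V (fccPoint b), fccPoint b⟫ (qformFI (hgramD c w (scaleL c)) b) := fun b => by
    rw [inner_apply_fccPoint_eq_sum]
    exact mem_qformFI (fun i j => mem_hgramFI V hE' i j) b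
  have hN : ∀ b, FI.mem (‖latPt U fccVec b‖ ^ 2) (qformFI (gramT c w) b) := fun b => mem_normSq_latPt U hbox b
  have hlamm : FI.mem lam (FI.ofScaled (scaleL c)) := FI.mem_ofScaled (scaleL c)
  -- kissing labels: `‖U q‖² = λ² + 2λ⟪Vq,q⟫ + ‖Vq‖²`
  have hkiss : ∀ b ∈ K12, FI.mem (‖U (fccPoint b)‖ ^ 2) (kissSq c w (scaleL c) b) := fun b hb => by
    have hq1 : ‖fccPoint b‖ = 1 := norm_eq_one_of_mem_fccKissingPattern (fccPoint_mem_pattern hb)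
    have e : ‖U (fccPoint b)‖ ^ 2 = lam * lam + (lam * ⟪V (fccPoint b), fccPoint b⟫ * ((2 : ℤ) : ℝ) + ‖V (fccPoint b)‖ ^ 2) := by
      rw [hV, norm_add_sq_real, norm_smul, Real.norm_eq_abs, hq1, real_inner_smul_left, real_inner_comm]
      push_cast; rw [mul_one, sq_abs]; ring
    rw [e]
    exact FI.mem_add (FI.mem_mul hlamm hlamm) (FI.mem_add (FI.mem_mulInt (FI.mem_mul hlamm (hP' b)) 2) (hN' b))
  -- the minimum `d` of the twelve lengths and its enclosures
  have hneP : fccKissingPattern.Nonempty := by rw [← Finset.card_pos, card_fccKissingPattern]; norm_num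
  obtain ⟨q₀, hq₀, hdq₀⟩ := Finset.exists_mem_eq_inf' hneP (fun q : E3 => ‖U q‖)
  have hd_le : ∀ q ∈ fccKissingPattern, ‖U q₀‖ ≤ ‖U q‖ := fun q hq => by rw [← hdq₀]; exact Finset.inf'_le _ hq
  have hd0 : 0 ≤ ‖U q₀‖ := norm_nonneg _
  have hDsq_lo : ∀ q ∈ fccKissingPattern, ((dSq c w (scaleL c)).lo : ℝ) ≤ ‖U q‖ ^ 2 * SC := fun q hq => by
    obtain ⟨b, hb, rfl⟩ := exists_label_of_mem_pattern hq
    have h1 : lmin (K12.map fun b => (kissSq c w (scaleL c) b).lo) ≤ (kissSq c w (scaleL c) b).lo :=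
      lmin_le_of_mem _ _ (List.mem_map.2 ⟨b, hb, rfl⟩)
    have h1' : ((lmin (K12.map fun b => (kissSq c w (scaleL c) b).lo) : ℤ) : ℝ) ≤ (kissSq c w (scaleL c) b).lo := by exact_mod_cast h1
    exact h1'.trans (FI.mem_def.1 (hkiss b hb)).1
  have hmemDsq : FI.mem (‖U q₀‖ ^ 2) (dSq c w (scaleL c)) := by
    refine ⟨hDsq_lo q₀ hq₀, ?_⟩
    have hl : (K12.map fun b => (kissSq c w (scaleL c) b).hi) ≠ [] := by simp [K12]
    obtain ⟨b', hb', he⟩ := List.mem_map.1 (lmin_mem _ hl)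
    have hpat := fccPoint_mem_pattern hb'
    have h2 := (FI.mem_def.1 (hkiss b' hb')).2
    have hle : ‖U q₀‖ ^ 2 ≤ ‖U (fccPoint b')‖ ^ 2 := pow_le_pow_left₀ hd0 (hd_le _ hpat) 2
    have hle' := mul_le_mul_of_nonneg_right hle hS.le
    show ‖U q₀‖ ^ 2 * SC ≤ (((dSq c w (scaleL c)).hi : ℤ) : ℝ)
    rw [show (dSq c w (scaleL c)).hi = lmin (K12.map fun b => (kissSq c w (scaleL c) b).hi) from rfl, ← he]
    linarith
  have hmemD : FI.mem ‖U q₀‖ (dEncl c w (scaleL c)) := by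
    have := FI.mem_sqrt hmemDsq
    rwa [Real.sqrt_sq hd0] at this
  obtain ⟨hDlo, hDhi⟩ := FI.mem_def.1 hmemD
  have h0' : (0 : ℝ) < (dEncl c w (scaleL c)).lo := by exact_mod_cast h0
  have hDhi0 : (0 : ℝ) ≤ (dEncl c w (scaleL c)).hi := by exact_mod_cast (h0.le.trans h01)
  refine pruneFcc_of_centre_good (goodAtScale_of_fitBounds_min U hU (dlo := ((dEncl c w (scaleL c)).lo : ℝ) / SC)
    (dhi := ((dEncl c w (scaleL c)).hi : ℝ) / SC) (d2lo := ((dSq c w (scaleL c)).lo : ℝ) / SC) (div_pos h0' hS) ?_ ?_ ?_ ?_ ?_ ?_ ?_ ?_)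
  · -- dhi ≤ 3/2
    rw [div_le_iff₀ hS]
    have : (2 : ℝ) * (dEncl c w (scaleL c)).hi ≤ 3 * SC := by exact_mod_cast h32
    linarith
  · -- 8 thr² < 27
    have hthr' : (8 : ℝ) * (130 * (dEncl c w (scaleL c)).hi + SC) ^ 2 < 270000 * (SC * SC) := by exact_mod_cast hthr
    have e : (13 : ℝ) / 10 * ((dEncl c w (scaleL c)).hi / SC) + 1 / 100 = (130 * (dEncl c w (scaleL c)).hi + SC) / (100 * SC) := by
      field_simp; ring
    rw [e, div_pow, show (8 : ℝ) * ((130 * ((dEncl c w (scaleL c)).hi : ℝ) + SC) ^ 2 / (100 * SC) ^ 2) =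
      (8 * (130 * ((dEncl c w (scaleL c)).hi : ℝ) + SC) ^ 2) / (100 * SC) ^ 2 by ring, div_lt_iff₀ (by positivity)]
    linarith
  · -- (d) lower
    intro q hq
    have := mul_le_mul_of_nonneg_right (hd_le q hq) hS.le
    rw [div_le_iff₀ hS]
    linarith
  · -- (d) upper
    exact ⟨q₀, hq₀, by rw [le_div_iff₀ hS]; exact hDhi⟩
  · -- d2lo ≤ ‖U q‖²
    intro q hq
    rw [div_le_iff₀ hS]
    exact hDsq_lo q hq
  · -- (F1) the sharp fit at the minimising scale: `‖Uq − d q‖² = (⟪Uq,q⟫ − d)² + (‖Uq‖² − ⟪Uq,q⟫²)`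
    intro q hq q' hq' hmin
    obtain ⟨b, hb, rfl⟩ := exists_label_of_mem_pattern hq
    obtain ⟨b', hb', rfl⟩ := exists_label_of_mem_pattern hq'
    obtain ⟨⟨f0, f1⟩, _⟩ := hK b hb
    have hq1 : ‖fccPoint b‖ = 1 := norm_eq_one_of_mem_fccKissingPattern hq
    have hq1' : ‖fccPoint b'‖ = 1 := norm_eq_one_of_mem_fccKissingPattern hq'
    -- the data: `P = ⟪Vq,q⟫`, `N = ‖Vq‖²`, `⟪Uq,q⟫ = λ + P`, `‖Uq‖² = λ² + 2λP + N`
    set P := ⟪V (fccPoint b), fccPoint b⟫ with hPdef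
    set N := ‖V (fccPoint b)‖ ^ 2 with hNdef
    set d := ‖U (fccPoint b')‖ with hddef
    have hPm := hP' b
    have hNm := hN' b
    have hinner : ⟪U (fccPoint b), fccPoint b⟫ = lam + P := by
      rw [hV, inner_add_left, real_inner_smul_left, real_inner_self_eq_norm_sq, hq1]; ring
    have hnormsq : ‖U (fccPoint b)‖ ^ 2 = lam * lam + 2 * lam * P + N := by
      rw [hV, norm_add_sq_real, norm_smul, Real.norm_eq_abs, hq1, real_inner_smul_left, real_inner_comm, abs_of_nonneg hlam0]; ring
    -- Pythagoras for the misfit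
    have hpy : ‖U (fccPoint b) - d • fccPoint b‖ ^ 2 = (lam + P - d) ^ 2 + (N - P ^ 2) := by
      rw [norm_sub_sq_real, inner_smul_right, hinner, norm_smul, Real.norm_eq_abs, hq1, mul_one, sq_abs, hnormsq]; ring
    -- tangential part: `0 ≤ N − P²` (Cauchy–Schwarz) and `N − P² ≤ T2/SC`
    have hcs : P ≤ ‖V (fccPoint b)‖ := by
      have := real_inner_le_norm (V (fccPoint b)) (fccPoint b); rw [hq1, mul_one] at this; exact this
    have hcs' : -‖V (fccPoint b)‖ ≤ P := by
      have := real_inner_le_norm (V (fccPoint b)) (-(fccPoint b))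
      rw [inner_neg_right, norm_neg, hq1, mul_one] at this; linarith
    have ht0 : 0 ≤ N - P ^ 2 := by
      have : P ^ 2 ≤ ‖V (fccPoint b)‖ ^ 2 := sq_le_sq' hcs' hcs
      linarith
    have hT : FI.mem (N - P * P) ((qformFI (gramD c w (scaleL c)) b).sub ((qformFI (hgramD c w (scaleL c)) b).mul (qformFI (hgramD c w (scaleL c)) b))) :=
      FI.mem_sub hNm (FI.mem_mul hPm hPm)
    have hThi : (N - P ^ 2) * SC ≤ (tangHi c w (scaleL c) b : ℝ) := by
      have h1 := (FI.mem_def.1 hT).2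
      have h2 : (((qformFI (gramD c w (scaleL c)) b).sub ((qformFI (hgramD c w (scaleL c)) b).mul (qformFI (hgramD c w (scaleL c)) b))).hi : ℝ) ≤
          (tangHi c w (scaleL c) b : ℝ) := by
        have := le_max_right 0 ((qformFI (gramD c w (scaleL c)) b).sub ((qformFI (hgramD c w (scaleL c)) b).mul (qformFI (hgramD c w (scaleL c)) b))).hi
        unfold tangHi; exact_mod_cast this
      rw [show N - P ^ 2 = N - P * P by ring]; exact h1.trans h2
    have hTnn : (0 : ℝ) ≤ tangHi c w (scaleL c) b := by exact_mod_cast le_max_left 0 _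
    -- radial part, upper: `λ + P − d ≤ P − ⟪Vq',q'⟫ ≤ (P.hi − Pmin)/SC`
    have hinner' : ⟪U (fccPoint b'), fccPoint b'⟫ = lam + ⟪V (fccPoint b'), fccPoint b'⟫ := by
      rw [hV, inner_add_left, real_inner_smul_left, real_inner_self_eq_norm_sq, hq1']; ring
    have hdlow : lam + ⟪V (fccPoint b'), fccPoint b'⟫ ≤ d := by
      rw [← hinner']
      have := real_inner_le_norm (U (fccPoint b')) (fccPoint b'); rw [hq1', mul_one] at this; exact this
    have hPmin : (pMin c w (scaleL c) : ℝ) ≤ ⟪V (fccPoint b'), fccPoint b'⟫ * SC := by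
      have h1 : lmin (K12.map fun b => (qformFI (hgramD c w (scaleL c)) b).lo) ≤ (qformFI (hgramD c w (scaleL c)) b').lo :=
        lmin_le_of_mem _ _ (List.mem_map.2 ⟨b', hb', rfl⟩)
      have h1' : (pMin c w (scaleL c) : ℝ) ≤ (qformFI (hgramD c w (scaleL c)) b').lo := by unfold pMin; exact_mod_cast h1
      exact h1'.trans (FI.mem_def.1 (hP' b')).1
    have hPhi := (FI.mem_def.1 hPm).2
    have hR1 : (lam + P - d) * SC ≤ (max 0 ((qformFI (hgramD c w (scaleL c)) b).hi - pMin c w (scaleL c)) : ℤ) := by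
      have : (lam + P - d) * SC ≤ ((qformFI (hgramD c w (scaleL c)) b).hi : ℝ) - pMin c w (scaleL c) := by
        have h3 := mul_le_mul_of_nonneg_right hdlow hS.le
        have e3 : (lam + ⟪V (fccPoint b'), fccPoint b'⟫) * SC = lam * SC + ⟪V (fccPoint b'), fccPoint b'⟫ * SC := by ring
        have e4 : (lam + P - d) * SC = lam * SC + P * SC - d * SC := by ring
        rw [e3] at h3; rw [e4]; linarith
      have h2 : (((qformFI (hgramD c w (scaleL c)) b).hi - pMin c w (scaleL c) : ℤ) : ℝ) ≤
          (max 0 ((qformFI (hgramD c w (scaleL c)) b).hi - pMin c w (scaleL c)) : ℤ) := by exact_mod_cast le_max_right _ _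
      push_cast at h2 ⊢; linarith
    -- radial part, lower: `λ + P − d ≥ ⟪Uq,q⟫ − ‖Uq‖ ≥ −(N − P²)` (using `d ≤ ‖Uq‖` and `2⟪Uq,q⟫ ≥ 1`)
    have hdq : d ≤ ‖U (fccPoint b)‖ := hmin _ hq
    have hpos : (1 : ℝ) ≤ 2 * (lam + P) := by
      have f0' : (SC : ℝ) ≤ 2 * (scaleL c + (qformFI (hgramD c w (scaleL c)) b).lo) := by exact_mod_cast f0
      have hPlo := (FI.mem_def.1 hPm).1
      have e : lam * SC = scaleL c := by rw [hlam]; exact div_mul_cancel₀ _ hne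
      have : 1 * (SC : ℝ) ≤ 2 * (lam + P) * SC := by
        rw [show 2 * (lam + P) * (SC : ℝ) = 2 * (lam * SC) + 2 * (P * SC) by ring, e]; linarith
      exact le_of_mul_le_mul_right this hS
    have hlowr : -(N - P ^ 2) ≤ lam + P - d := by
      -- `‖Uq‖ − ⟪Uq,q⟫ = (N − P²)/(‖Uq‖ + ⟪Uq,q⟫) ≤ N − P²` since the denominator is `≥ 2⟪Uq,q⟫ ≥ 1`
      have hUq : ⟪U (fccPoint b), fccPoint b⟫ ≤ ‖U (fccPoint b)‖ := by
        have := real_inner_le_norm (U (fccPoint b)) (fccPoint b); rw [hq1, mul_one] at this; exact this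
      rw [hinner] at hUq
      have hden : 1 ≤ ‖U (fccPoint b)‖ + (lam + P) := by linarith
      have hprod : (‖U (fccPoint b)‖ - (lam + P)) * (‖U (fccPoint b)‖ + (lam + P)) = N - P ^ 2 := by
        rw [show (‖U (fccPoint b)‖ - (lam + P)) * (‖U (fccPoint b)‖ + (lam + P)) = ‖U (fccPoint b)‖ ^ 2 - (lam + P) ^ 2 by ring, hnormsq]
        ring
      have hdiff : ‖U (fccPoint b)‖ - (lam + P) ≤ N - P ^ 2 := by
        have h1 : 0 ≤ ‖U (fccPoint b)‖ - (lam + P) := by linarith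
        have h2 := mul_le_mul_of_nonneg_left hden h1
        rw [mul_one, hprod] at h2
        exact h2
      linarith
    -- assemble: misfit² ≤ (R1² + T2²)/SC² + T2/SC ≤ η'² · Dsq.lo/SC
    have f1' : (1000000 : ℝ) * (((max 0 ((qformFI (hgramD c w (scaleL c)) b).hi - pMin c w (scaleL c)) : ℤ) : ℝ) ^ 2 +
        (tangHi c w (scaleL c) b : ℝ) ^ 2 + (tangHi c w (scaleL c) b : ℝ) * SC) ≤ 2401 * (dSq c w (scaleL c)).lo * SC := by
      exact_mod_cast f1
    have hR0 : (0 : ℝ) ≤ ((max 0 ((qformFI (hgramD c w (scaleL c)) b).hi - pMin c w (scaleL c)) : ℤ) : ℝ) := by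
      exact_mod_cast le_max_left _ _
    have hrsq : ((lam + P - d) * SC) ^ 2 ≤ (((max 0 ((qformFI (hgramD c w (scaleL c)) b).hi - pMin c w (scaleL c)) : ℤ) : ℝ)) ^ 2 +
        (tangHi c w (scaleL c) b : ℝ) ^ 2 := by
      rcases le_total 0 (lam + P - d) with hr | hr
      · have := pow_le_pow_left₀ (mul_nonneg hr hS.le) hR1 2
        linarith [sq_nonneg (tangHi c w (scaleL c) b : ℝ)]
      · have h1 : (-(lam + P - d)) * SC ≤ (tangHi c w (scaleL c) b : ℝ) := by
          have h4 : -(lam + P - d) ≤ N - P ^ 2 := by linarith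
          have h5 := mul_le_mul_of_nonneg_right h4 hS.le
          linarith
        have := pow_le_pow_left₀ (mul_nonneg (neg_nonneg.2 hr) hS.le) h1 2
        have e : (-(lam + P - d) * SC) ^ 2 = ((lam + P - d) * SC) ^ 2 := by ring
        rw [e] at this
        linarith [sq_nonneg (((max 0 ((qformFI (hgramD c w (scaleL c)) b).hi - pMin c w (scaleL c)) : ℤ) : ℝ))]
    rw [hpy, show (49 / 1000 : ℝ) ^ 2 * (((dSq c w (scaleL c)).lo : ℝ) / SC) = 2401 * ((dSq c w (scaleL c)).lo : ℝ) / (1000000 * SC) by ring,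
      le_div_iff₀ (by positivity)]
    have e1 : ((lam + P - d) ^ 2 + (N - P ^ 2)) * (1000000 * SC) * SC =
        1000000 * (((lam + P - d) * SC) ^ 2 + ((N - P ^ 2) * SC) * SC) := by ring
    have key : ((lam + P - d) ^ 2 + (N - P ^ 2)) * (1000000 * SC) * SC ≤ 2401 * ((dSq c w (scaleL c)).lo : ℝ) * SC := by
      rw [e1]
      have h3 := mul_le_mul_of_nonneg_right hThi hS.le
      linarith [hrsq, h3, f1']
    exact le_of_mul_le_mul_right key hS
  · -- (F2) clean gap
    intro q hq
    obtain ⟨b, hb, rfl⟩ := exists_label_of_mem_pattern hq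
    obtain ⟨_, f3⟩ := hK b hb
    have hC := (FI.mem_def.1 (hkiss b hb)).2
    have f3' : ((kissSq c w (scaleL c) b).hi : ℝ) * SC * 10000 ≤ (130 * (dEncl c w (scaleL c)).lo - SC) ^ 2 := by exact_mod_cast f3
    have h130' : (SC : ℝ) ≤ 130 * (dEncl c w (scaleL c)).lo := by exact_mod_cast h130
    have hC' := mul_le_mul_of_nonneg_right hC (by positivity : (0 : ℝ) ≤ SC * 10000)
    have hsq : (‖U (fccPoint b)‖ * (100 * SC)) ^ 2 ≤ ((130 : ℝ) * (dEncl c w (scaleL c)).lo - SC) ^ 2 := by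
      have e : (‖U (fccPoint b)‖ * (100 * SC)) ^ 2 = ‖U (fccPoint b)‖ ^ 2 * SC * (SC * 10000) := by ring
      rw [e]; linarith
    have hle := (abs_le_of_sq_le_sq' hsq (by linarith)).2
    rw [show (13 : ℝ) / 10 * (((dEncl c w (scaleL c)).lo : ℝ) / SC) - 1 / 100 = (130 * ((dEncl c w (scaleL c)).lo : ℝ) - SC) / (100 * SC) by
      field_simp; ring, le_div_iff₀ (by positivity)]
    exact hle
  · -- (F3) far
    intro b hb hb0 hrec
    rw [← box2_eq] at hb
    have f4 : ((130 : ℝ) * (dEncl c w (scaleL c)).hi + SC) ^ 2 ≤ ((qformFI (gramT c w) b).lo : ℝ) * SC * 10000 := by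
      exact_mod_cast hfar b hb hb0 hrec
    have hC := (FI.mem_def.1 (hN b)).1
    have hC' := mul_le_mul_of_nonneg_right hC (by positivity : (0 : ℝ) ≤ SC * 10000)
    have hsq : ((130 : ℝ) * (dEncl c w (scaleL c)).hi + SC) ^ 2 ≤ (‖latPt U fccVec b‖ * (100 * SC)) ^ 2 := by
      have e : (‖latPt U fccVec b‖ * (100 * SC)) ^ 2 = ‖latPt U fccVec b‖ ^ 2 * SC * (SC * 10000) := by ring
      rw [e]; linarith
    have hle := (abs_le_of_sq_le_sq' hsq (by positivity)).2
    rw [show (13 : ℝ) / 10 * (((dEncl c w (scaleL c)).hi : ℝ) / SC) + 1 / 100 = (130 * ((dEncl c w (scaleL c)).hi : ℝ) + SC) / (100 * SC) by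
      field_simp; ring, div_le_iff₀ (by positivity)]
    exact hle
/-! ## §3. The combined verdict and the fcc half -/
/-- ★ **ENTRY-LEAF VERDICT with the sharp fit**: `fitOK2 ∨ (fitOK ∨ symmetry ∨ column ∨ (P4))`. -/
def entryLeafOKF2 (μ : ℤ) (c w : Fin 3 × Fin 3 → ℤ) : Bool := fitOK2 c w || entryLeafOKF μ c w

/-- ★ Soundness of `entryLeafOKF2` (shape of `…HomEntryGram.fccHalf_of_entryTree`). [folklore] -/
theorem entryLeafOKF2_sound {μ : ℤ} {c w : Fin 3 × Fin 3 → ℤ} (h : entryLeafOKF2 μ c w = true) (U : E3 →L[ℝ] E3)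
    (hsa : ∀ v v' : E3, ⟪U v, v'⟫ = ⟪v, U v'⟫) (hU : ‖U - 1‖ ≤ 1 / 4)
    (hbox : ∀ ab : Fin 3 × Fin 3, |(U (EuclideanSpace.single ab.2 (1 : ℝ))) ab.1 - (c ab : ℝ) / SC| ≤ (w ab : ℝ) / SC) :
    (∀ (M : ℕ) (z : Fin M → E3) (c : Fin M), Function.Injective z →
        Set.range z = {x : E3 | dist x (z c) ≤ 133 / 10 ∧ ∃ a : Fin 3 → ℤ, x = z c + latPt U fccVec a} →
        TightNearCap (9 / 5) (3 / 2) z c ∨ ExemptNear (9 / 5) ExRec z c ∨ BadNearCap (9 / 5) (3 / 2) z c) ∨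
      (μ : ℝ) / SC ≤ ∑ b ∈ (Fintype.piFinset fun _ : Fin 3 => Finset.Icc (-7 : ℤ) 7).filter (fun b => b ≠ 0),
        effPot w₄₅ ω₄ (3 / 400) ‖latPt U fccVec b‖ := by
  simp only [entryLeafOKF2, Bool.or_eq_true] at h
  rcases h with h | h
  · exact Or.inl (fitOK2_sound h U hU hbox)
  · exact entryLeafOKF_sound h U hsa hU hbox

/-- ★★★ **THE fcc HALF OF `(H)` FROM ONE BOOLEAN with the sharp fit prune.** [folklore] -/
theorem fccHalf_of_entryFit2Tree {m : ℝ} {μ : ℤ} (hμ : 2 * (m + (-(7175 / 10000) + 3 / 400)) * SC ≤ μ)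
    {t : CertTree (Fin 3 × Fin 3)} (h : treeOK (entryLeafOKF2 μ) t rootC rootW = true) :
    ∀ U : E3 →L[ℝ] E3, (∀ v w : E3, inner ℝ (U v) w = inner ℝ v (U w)) → (∀ w : E3, 0 ≤ inner ℝ w (U w)) → ‖U - 1‖ ≤ 1 / 4 →
      (∀ (M : ℕ) (z : Fin M → E3) (c : Fin M), Function.Injective z →
          Set.range z = {x : E3 | dist x (z c) ≤ 133 / 10 ∧ ∃ a : Fin 3 → ℤ, x = z c + latPt U fccVec a} →
          TightNearCap (9 / 5) (3 / 2) z c ∨ ExemptNear (9 / 5) ExRec z c ∨ BadNearCap (9 / 5) (3 / 2) z c) ∨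
      m ≤ (∑ b ∈ (Fintype.piFinset fun _ : Fin 3 => Finset.Icc (-7 : ℤ) 7).filter (fun b => b ≠ 0),
        effPot w₄₅ ω₄ (3 / 400) ‖latPt U fccVec b‖) / 2 - (-(7175 / 10000) + 3 / 400) :=
  fccHalf_of_entryTree hμ (entryLeafOKF2 μ) (fun _ _ hv U hsa hU hbox => entryLeafOKF2_sound hv U hsa hU hbox) h
/-! ## §4. Kernel smoke test: the sharp fit closes the measured gap -/
/-- `fitOK2` fires at `U = 0.97·diag(1.04, 1, 1)` (entry half-width `2⁻¹⁰`), where `fitOK` fails (the measured gap; (P4) holds from `e = 0.05` on). -/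
example : fitOK2 (fun ab => if ab.1 = ab.2 then (if ab.1 = 0 then 283951956505709 else 273030727409336) else 0) (fun _ => 274877906944) = true ∧
    fitOK (fun ab => if ab.1 = ab.2 then (if ab.1 = 0 then 283951956505709 else 273030727409336) else 0) (fun _ => 274877906944) = false := by
  decide +kernel
end Summit.AtomisticToContinuum.Crystallization.Theorems.FrustratedLawDichotomyStrainedPatchHomEntryFitSharp
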